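import Literature.MathematicalPhysics.QuantumManyBody.CentreOfMassKineticEnergy
import Literature.MathematicalPhysics.QuantumManyBody.SwapPurity
import Mathlib.MeasureTheory.Group.LIntegral
import Mathlib.MeasureTheory.Integral.Prod
import Mathlib.MeasureTheory.Integral.IntervalIntegral.Basic
import Mathlib.Analysis.Normed.Group.Bounded
import Mathlib.Analysis.InnerProductSpace.Calculus
import Mathlib.Analysis.SpecialFunctions.Sqrt
import Mathlib.Analysis.SpecialFunctions.Pow.Real
import Mathlib.Analysis.SpecialFunctions.Trigonometric.Basic
import HarnessLib

/-!
# Crux `RigidMomentumBound` (stmt-AtomisticToContinuum-13034), line `registered`: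
# the smeared square `F(X) = ∫₀^{2τ} |Φ(X - t𝟙ₐ)|² w(t) dt` (part 3 of the smearing step)

Supports (does not close) stmt-AtomisticToContinuum-13034. Given the calculus facts (H2) and the
weight facts (H3) of the registered stub `stub_smearStep` as hypotheses on abstract `F, w, u, w'`
(instantiated definitionally in the final file), we derive: `0 ≤ F ≤ sup|Φ|²`, `F = 0` off the
enlarged box, permutation invariance, `∫ F = 1`, and the two pointwise Cauchy–Schwarz bounds
`(DF(X)Y)² ≤ 4 F(X) ∫|DΦ(X-t𝟙ₐ)Y|²w` and `(DF(X)𝟙ₐ)² ≤ F(X) ∫|Φ(X-t𝟙ₐ)|²u` in `ℝ≥0∞` form.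
Folklore analysis (Lieb–Loss, *Analysis*, Thm 7.8 for the idea).
-/

noncomputable section

open MeasureTheory Filter Set
open scoped ENNReal NNReal Topology

namespace Summit.AtomisticToContinuum.BoseEinsteinCondensation.Theorems.RigidMomentumBound

open Literature.MathematicalPhysics.QuantumManyBody.BoseGas

namespace SmearStep

variable {N : ℕ} {L₀ : ℝ}

/-! ### The wave function: boundedness, measurability -/

/-- `√(3L²) ≤ 2|L| + 1` (registered sub-goal anchoring this helper file on the crux item). [folklore] -/
theorem sqrt_three_mul_sq_le : ∀ L : ℝ, Real.sqrt (3 * L ^ 2) ≤ 2 * |L| + 1 := by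
  intro L
  rw [Real.sqrt_le_left (by positivity)]
  nlinarith [abs_nonneg L, sq_abs L]

/-- Configurations in the `N`-particle box have (sup-)norm at most `2|L| + 1`. [folklore] -/
theorem norm_le_of_mem_boxN {N : ℕ} {L : ℝ} {X : Config N} (hX : X ∈ boxN N L) :
    ‖X‖ ≤ 2 * |L| + 1 := by
  -- adapted from Literature/.../DyadicCoherentFractionLimit.lean (`isBounded_boxN'`)
  refine (pi_norm_le_iff_of_nonneg (by positivity)).2 fun i => ?_
  have hx := hX i
  rw [EuclideanSpace.norm_eq]
  have hcoord : ∀ k, ‖(X i) k‖ ^ 2 ≤ L ^ 2 := fun k => by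
    have hk := hx k
    rw [Real.norm_eq_abs, sq_abs]
    rw [Set.mem_Ioo] at hk
    nlinarith [hk.1, hk.2]
  calc Real.sqrt (∑ k, ‖(X i) k‖ ^ 2) ≤ Real.sqrt (∑ _k : Fin 3, L ^ 2) :=
        Real.sqrt_le_sqrt (Finset.sum_le_sum fun k _ => hcoord k)
    _ = Real.sqrt (3 * L ^ 2) := by simp
    _ ≤ 2 * |L| + 1 := sqrt_three_mul_sq_le L

/-- The `N`-particle box lies in the closed ball of radius `2|L| + 1`. [folklore] -/
theorem boxN_subset_closedBall (N : ℕ) (L : ℝ) :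
    boxN N L ⊆ Metric.closedBall (0 : Config N) (2 * |L| + 1) := fun X hX => by
  rw [Metric.mem_closedBall, dist_zero_right]
  exact norm_le_of_mem_boxN hX

/-- Admissible trial states have compact support. [folklore] -/
theorem hasCompactSupport_psi (Φ : TrialState N L₀) : HasCompactSupport Φ.ψ :=
  -- the box is bounded (`Literature…BoseGas.isBounded_boxN`, not imported: heavy cone), hence relatively compact
  HasCompactSupport.intro
    (Metric.isBounded_closedBall.subset (boxN_subset_closedBall N L₀)).isCompact_closure fun X hX =>
    Φ.eq_zero X fun h => hX (subset_closure h)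

/-- `|Φ|` is bounded: `‖Φ Z‖² ≤ M` for some `M ≥ 0`. [folklore] -/
theorem exists_bound_norm_sq (Φ : TrialState N L₀) : ∃ M : ℝ, 0 ≤ M ∧ ∀ Z, ‖Φ.ψ Z‖ ^ 2 ≤ M := by
  obtain ⟨C, hC⟩ := (hasCompactSupport_psi Φ).exists_bound_of_continuous Φ.contDiff.continuous
  refine ⟨C ^ 2, sq_nonneg C, fun Z => ?_⟩
  have h0 : 0 ≤ C := (norm_nonneg _).trans (hC Z)
  exact pow_le_pow_left₀ (norm_nonneg _) (hC Z) 2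

/-- `Z ↦ ‖Φ Z‖²` is continuous. [folklore] -/
theorem continuous_norm_sq (Φ : TrialState N L₀) : Continuous fun Z : Config N => ‖Φ.ψ Z‖ ^ 2 :=
  (Φ.contDiff.continuous.norm).pow 2

/-! ### The weight -/

section weight

variable {τ : ℝ} {w u w' : ℝ → ℝ}

/-- The weight `w(t) = τ⁻¹ sin²(πt/(2τ))` is non-negative (`τ > 0`). [folklore] -/
theorem w_nonneg (hτ : 0 < τ) (hw : w = fun t => τ⁻¹ * Real.sin (Real.pi * t / (2 * τ)) ^ 2) (t : ℝ) :
    0 ≤ w t := by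
  subst hw
  exact mul_nonneg (inv_nonneg.2 hτ.le) (sq_nonneg _)

/-- `u(t) = (π²/τ³) cos²(πt/(2τ))` is non-negative (`τ > 0`). [folklore] -/
theorem u_nonneg (hτ : 0 < τ) (hu : u = fun t => Real.pi ^ 2 / τ ^ 3 * Real.cos (Real.pi * t / (2 * τ)) ^ 2)
    (t : ℝ) : 0 ≤ u t := by
  subst hu
  exact mul_nonneg (by positivity) (sq_nonneg _)

/-- The weight is continuous. [folklore] -/
theorem w_continuous (hw : w = fun t => τ⁻¹ * Real.sin (Real.pi * t / (2 * τ)) ^ 2) : Continuous w := by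
  subst hw; fun_prop

/-- `u` is continuous. [folklore] -/
theorem u_continuous (hu : u = fun t => Real.pi ^ 2 / τ ^ 3 * Real.cos (Real.pi * t / (2 * τ)) ^ 2) :
    Continuous u := by
  subst hu; fun_prop

/-- `w'` is continuous. [folklore] -/
theorem w'_continuous (hw' : w' = fun t => Real.pi / (2 * τ ^ 2) * Real.sin (Real.pi * t / τ)) :
    Continuous w' := by
  subst hw'; fun_prop

/-- `|w'| = √w · √u` (from `w'² = w u`, `w, u ≥ 0`). [folklore] -/
theorem abs_w'_eq (hw0 : ∀ t, 0 ≤ w t) (hwu : ∀ t, (w' t) ^ 2 = w t * u t) (t : ℝ) :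
    |w' t| = Real.sqrt (w t) * Real.sqrt (u t) := by
  rw [← Real.sqrt_sq_eq_abs, hwu t, Real.sqrt_mul (hw0 t)]

end weight

/-! ### The smeared square -/

section smearedSquare

variable (Φ : TrialState N L₀) (a : Fin 3) {τ : ℝ} (hτ : 0 < τ) {w : ℝ → ℝ}
  (hw0 : ∀ t, 0 ≤ w t) (hwc : Continuous w) {F : Config N → ℝ}
  (hF : F = fun X => ∫ t in (0 : ℝ)..(2 * τ),
    ‖Φ.ψ (X - t • (fun _ : Fin N => EuclideanSpace.single a (1 : ℝ)))‖ ^ 2 * w t)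

include hτ hw0 hF in
/-- `F ≥ 0`. [folklore] -/
theorem F_nonneg (X : Config N) : 0 ≤ F X := by
  subst hF
  exact intervalIntegral.integral_nonneg (by linarith) fun t _ => mul_nonneg (sq_nonneg _) (hw0 t)

include hwc in
/-- The integrand `t ↦ ‖Φ(X - t𝟙ₐ)‖² w(t)` is continuous. [folklore] -/
theorem continuous_integrand (X : Config N) :
    Continuous fun t : ℝ =>
      ‖Φ.ψ (X - t • (fun _ : Fin N => EuclideanSpace.single a (1 : ℝ)))‖ ^ 2 * w t := by
  refine Continuous.mul ?_ hwc
  exact ((Φ.contDiff.continuous.comp (continuous_const.sub (continuous_id.smul continuous_const))).norm).pow 2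

include hτ hw0 hwc hF in
/-- `F ≤ M ∫w` where `‖Φ‖² ≤ M`: with `∫₀^{2τ} w = 1`, `F ≤ M`. [folklore] -/
theorem F_le (hw1 : ∫ t in (0 : ℝ)..(2 * τ), w t = 1) {M : ℝ} (hM : ∀ Z, ‖Φ.ψ Z‖ ^ 2 ≤ M)
    (X : Config N) : F X ≤ M := by
  subst hF
  calc (∫ t in (0 : ℝ)..(2 * τ),
        ‖Φ.ψ (X - t • (fun _ : Fin N => EuclideanSpace.single a (1 : ℝ)))‖ ^ 2 * w t)
      ≤ ∫ t in (0 : ℝ)..(2 * τ), M * w t := by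
        refine intervalIntegral.integral_mono_on (by linarith)
          ((continuous_integrand Φ a hwc X).intervalIntegrable _ _)
          ((continuous_const.mul hwc).intervalIntegrable _ _) fun t _ => ?_
        exact mul_le_mul_of_nonneg_right (hM _) (hw0 t)
    _ = M := by rw [intervalIntegral.integral_const_mul, hw1, mul_one]

include hF in
/-- `F` vanishes off the enlarged box `Λ_{L₀+2τ}^N`. [folklore] -/
theorem F_eq_zero_of_notMem (hτ0 : 0 ≤ τ) {X : Config N} (hX : X ∉ boxN N (L₀ + 2 * τ)) : F X = 0 := by
  subst hF
  dsimp only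
  rw [intervalIntegral.integral_congr (g := fun _ => (0 : ℝ)) ?_, intervalIntegral.integral_zero]
  intro t ht
  rw [Set.uIcc_of_le (by linarith)] at ht
  have hout : X - t • (fun _ : Fin N => EuclideanSpace.single a (1 : ℝ)) ∉ boxN N L₀ := by
    intro hmem
    apply hX
    intro i k
    have h := hmem i k
    have happ : (X - t • (fun _ : Fin N => EuclideanSpace.single a (1 : ℝ))) i k =
        X i k - t * (if k = a then 1 else 0) := by
      simp [EuclideanSpace.single, PiLp.single_apply]
    rw [happ] at h
    rw [Set.mem_Ioo] at h ⊢
    by_cases hk : k = a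
    · subst hk
      simp only [if_true, mul_one] at h
      constructor <;> linarith [h.1, h.2, ht.1, ht.2]
    · simp only [hk, if_false, mul_zero, sub_zero] at h
      constructor <;> linarith [h.1, h.2, ht.1, ht.2]
  dsimp only
  rw [Φ.eq_zero _ hout, norm_zero]
  ring

include hF in
/-- `F` is permutation symmetric. [folklore] -/
theorem F_comp_perm (σ : Equiv.Perm (Fin N)) (X : Config N) : F (X ∘ σ) = F X := by
  subst hF
  refine intervalIntegral.integral_congr fun t _ => ?_
  have h : (X ∘ σ : Config N) - t • (fun _ : Fin N => EuclideanSpace.single a (1 : ℝ)) =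
      (X - t • (fun _ : Fin N => EuclideanSpace.single a (1 : ℝ))) ∘ σ := by
    funext i; simp
  simp only [h, Φ.symm]

include hτ hw0 hwc hF in
/-- `ofReal (F X)` as a lower Lebesgue integral over `t ∈ (0, 2τ]`. [folklore] -/
theorem ofReal_F_eq (X : Config N) :
    ENNReal.ofReal (F X) = ∫⁻ t in Ioc (0 : ℝ) (2 * τ),
      ((‖Φ.ψ (X - t • (fun _ : Fin N => EuclideanSpace.single a (1 : ℝ)))‖₊ : ℝ≥0∞) ^ 2) *
        ENNReal.ofReal (w t) := by
  subst hF
  dsimp only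
  rw [intervalIntegral.integral_of_le (by linarith),
    ofReal_integral_eq_lintegral_ofReal
      (((continuous_integrand Φ a hwc X).integrableOn_Icc).mono_set Ioc_subset_Icc_self)
      (Eventually.of_forall fun t => mul_nonneg (sq_nonneg _) (hw0 t))]
  refine lintegral_congr fun t => ?_
  rw [ENNReal.ofReal_mul (sq_nonneg _), ENNReal.ofReal_pow (norm_nonneg _), ofReal_norm,
    enorm_eq_nnnorm]

include hτ hw0 hwc hF in
/-- **`∫ F = ∫ w`**, i.e. `∫ F = 1` for the normalised weight (Tonelli and translation invariance).
[folklore] -/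
theorem lintegral_ofReal_F (hw1 : ∫ t in (0 : ℝ)..(2 * τ), w t = 1) : ∫⁻ X, ENNReal.ofReal (F X) = 1 := by
  have hmeas : Measurable fun Z : Config N => ((‖Φ.ψ Z‖₊ : ℝ≥0∞) ^ 2) :=
    (Φ.contDiff.continuous.measurable.nnnorm.coe_nnreal_ennreal).pow_const 2
  simp_rw [ofReal_F_eq Φ a hτ hw0 hwc hF]
  rw [lintegral_lintegral_swap]
  · have h : ∀ t : ℝ, ∫⁻ X : Config N,
        ((‖Φ.ψ (X - t • (fun _ : Fin N => EuclideanSpace.single a (1 : ℝ)))‖₊ : ℝ≥0∞) ^ 2) *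
          ENNReal.ofReal (w t) = ENNReal.ofReal (w t) := fun t => by
      have hm : Measurable fun X : Config N =>
          ((‖Φ.ψ (X - t • (fun _ : Fin N => EuclideanSpace.single a (1 : ℝ)))‖₊ : ℝ≥0∞) ^ 2) :=
        hmeas.comp (measurable_id.sub measurable_const)
      rw [lintegral_mul_const _ hm,
        lintegral_sub_right_eq_self (fun Z : Config N => ((‖Φ.ψ Z‖₊ : ℝ≥0∞) ^ 2)) _, Φ.norm_eq,
        one_mul]
    simp_rw [h]
    rw [← ofReal_integral_eq_lintegral_ofReal (hwc.integrableOn_Icc.mono_set Ioc_subset_Icc_self)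
      (Eventually.of_forall fun t => hw0 t), ← intervalIntegral.integral_of_le (by linarith), hw1,
      ENNReal.ofReal_one]
  · refine ((hmeas.comp ?_).mul (ENNReal.measurable_ofReal.comp (hwc.measurable.comp
      measurable_snd))).aemeasurable
    exact (continuous_fst.sub (continuous_snd.smul continuous_const)).measurable

end smearedSquare

end SmearStep

end Summit.AtomisticToContinuum.BoseEinsteinCondensation.Theorems.RigidMomentumBound

end
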